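import Mathlib
import HarnessLib

/-!
# Approximating `1/x` away from the origin: the two analytic estimates of
# Childs–Kothari–Somma's Chebyshev approach to quantum linear systems

HONEST FRAMING: instance-level adjudication of specific advantage claims; no claim about
BQP vs BPP or the summit.

The quantum linear-systems algorithm of [cite: ChildsKothariSomma2017, §4] implements `A⁻¹`
as a linear combination of Chebyshev polynomials `𝒯_n(A/d)`.  Its analysis rests on three
lemmas about the real function `f(x) = (1 - (1 - x²)^b)/x`:

> **Lemma 17.** The function `f(x) := (1-(1-x^2)^b)/x` is `ε`-close to `1/x` on the domain
> `D_{κd} := [-1,-1/(κd)] ∪ [1/(κd),1]` for any integer `b ≥ (κd)² log(κd/ε)`.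
> [cite: ChildsKothariSomma2017, Lemma 17]

> **Lemma 18.** Over the domain `[-1,1]`, `f(x) = 4 ∑_{j=0}^{b-1} (-1)^j
> [∑_{i=j+1}^{b} binom(2b, b+i) / 2^{2b}] 𝒯_{2j+1}(x)`.  [cite: ChildsKothariSomma2017, Lemma 18]

> **Lemma 19.** The function `f(x)` can be `ε`-approximated by a linear combination of
> Chebyshev polynomials of order `O(√(b log(b/ε)))` by truncating the series of Lemma 18 at
> `j₀ = √(b log(4b/ε))`; the proof is the Chernoff bound
> `2^{-2b} ∑_{i=j+1}^{b} binom(2b, b+i) ≤ e^{-j²/b}` followed by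
> `|f(x)-g(x)| ≤ 4 ∑_{j=j₀+1}^{b-1} e^{-j²/b} |𝒯_{2j+1}(x)| ≤ 4b e^{-j₀²/b} = ε`, using
> `|𝒯_n(x)| ≤ 1` on `[-1,1]`.  [cite: ChildsKothariSomma2017, Lemma 19 and its proof]

This file proves, following the printed proofs line by line (with `K` standing for the paper's
`κd`):

* `abs_tamedInv_sub_inv_le` — **Lemma 17**: for `1 ≤ K`, `0 < ε`, an integer `b` with
  `K² log(K/ε) ≤ b`, and `1/K ≤ |x| ≤ 1`, `|f(x) - 1/x| ≤ ε`
  (via `(1 - 1/K²)^b ≤ e^{-b/K²} ≤ ε/K`, `one_sub_pow_le_exp_neg_mul`);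
* `choose_tail_div_le_exp` — the **Chernoff bound** of the proof of Lemma 19,
  `2^{-2b} ∑_{i=j+1}^{b} binom(2b,b+i) ≤ e^{-j²/b}`, proved by the exponential-moment method
  exactly as a Chernoff bound is (`∑_k binom(2b,k) e^{λk} = (1+e^λ)^{2b}`,
  `(1+e^λ)/2 = e^{λ/2} cosh(λ/2)`, Mathlib's `Real.cosh_le_exp_half_sq`, `λ = 2j/b`);
* `abs_chebCoeff_le` — the printed coefficients `c_j = 4(-1)^j[2^{-2b} ∑_{i>j} binom(2b,b+i)]`
  satisfy `|c_j| ≤ 4 e^{-j²/b}`;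
* `abs_chebSeries_sub_chebTrunc_le` and `abs_chebSeries_sub_chebTrunc_le_of_le` —
  **Lemma 19 as proved**: for `|x| ≤ 1` the tail of the printed Chebyshev series beyond `j₀`
  is at most `4b e^{-j₀²/b}`, hence at most `ε` as soon as `b log(4b/ε) ≤ j₀²`
  (Mathlib's `Polynomial.Chebyshev.abs_eval_T_real_le_one` supplies `|𝒯_n(x)| ≤ 1`).

What is NOT here: **Lemma 18** (the exact identity `f = ∑_{j<b} c_j 𝒯_{2j+1}` on `[-1,1]`,
a power-reduction computation for `sin^{2b} θ`) is not formalized — so the truncation statement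
is proved for the printed series `chebSeries b` rather than for `f` itself
(`-- TODO(Lemma 18): chebSeries b x = tamedInv b x for |x| ≤ 1`); nothing about the LCU
implementation, query complexity (Theorem 3 / Lemma 20) or gate counts.  No named facts,
no `sorry`.
-/

namespace Literature.Computability.QuantumAlgorithms

open Real Finset

namespace ChebyshevInverse

/-! ## §1 Lemma 17: taming `1/x` near the origin -/

/-- The tamed inverse `f_b(x) = (1 - (1 - x²)^b)/x` of
[cite: ChildsKothariSomma2017, Lemma 17, eq. (taming)]. -/
noncomputable def tamedInv (b : ℕ) (x : ℝ) : ℝ := (1 - (1 - x ^ 2) ^ b) / x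

/-- `f_b(x) - 1/x = -(1 - x²)^b / x` — the identity behind "Therefore we have
`|(1-(1-x²)^b)/x - 1/x| ≤ …`" in [cite: ChildsKothariSomma2017, proof of Lemma 17]. -/
theorem tamedInv_sub_inv (b : ℕ) (x : ℝ) :
    tamedInv b x - 1 / x = -((1 - x ^ 2) ^ b / x) := by
  unfold tamedInv
  rw [sub_div]
  ring

/-- `(1 - t)^b ≤ e^{-bt}` for `t ≤ 1` — the inequality `(1 - 1/(κd)²)^b ≤ e^{-b/(κd)²}` of the
printed proof. [cite: ChildsKothariSomma2017, proof of Lemma 17] -/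
theorem one_sub_pow_le_exp_neg_mul {t : ℝ} (ht : t ≤ 1) (b : ℕ) :
    (1 - t) ^ b ≤ exp (-(b * t)) := by
  have h0 : 0 ≤ 1 - t := by linarith
  have h1 : 1 - t ≤ exp (-t) := by linarith [add_one_le_exp (-t)]
  calc (1 - t) ^ b ≤ (exp (-t)) ^ b := pow_le_pow_left₀ h0 h1 b
    _ = exp (-(b * t)) := by rw [← exp_nat_mul]; ring_nf

/-- **Lemma 17** of [cite: ChildsKothariSomma2017, Lemma 17]: with `K = κd ≥ 1`, `ε > 0` and an
integer `b ≥ K² log(K/ε)`, the tamed inverse is `ε`-close to `1/x` on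
`D_K = {x : 1/K ≤ |x| ≤ 1}`. -/
theorem abs_tamedInv_sub_inv_le {K ε : ℝ} (hK : 1 ≤ K) (hε : 0 < ε) {b : ℕ}
    (hb : K ^ 2 * Real.log (K / ε) ≤ b) {x : ℝ} (hx1 : 1 / K ≤ |x|) (hx2 : |x| ≤ 1) :
    |tamedInv b x - 1 / x| ≤ ε := by
  have hK0 : 0 < K := by linarith
  have hxpos : 0 < |x| := lt_of_lt_of_le (by positivity) hx1
  -- `0 ≤ 1 - x² ≤ 1 - 1/K²`
  have hx2sq : x ^ 2 ≤ 1 := by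
    rw [← sq_abs]; exact pow_le_one₀ (abs_nonneg x) hx2
  have hx1sq : 1 / K ^ 2 ≤ x ^ 2 := by
    have h := mul_self_le_mul_self (by positivity) hx1
    rw [← sq, ← sq, sq_abs, one_div, inv_pow] at h
    rwa [one_div]
  have hbase0 : 0 ≤ 1 - x ^ 2 := by linarith
  have hbase1 : 1 - x ^ 2 ≤ 1 - 1 / K ^ 2 := by linarith
  -- `(1 - x²)^b ≤ (1 - 1/K²)^b ≤ e^{-b/K²} ≤ ε/K`
  have hpow : (1 - x ^ 2) ^ b ≤ ε / K := by
    calc (1 - x ^ 2) ^ b ≤ (1 - 1 / K ^ 2) ^ b := pow_le_pow_left₀ hbase0 hbase1 b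
      _ ≤ exp (-(b * (1 / K ^ 2))) :=
          one_sub_pow_le_exp_neg_mul (by rw [one_div]; exact inv_le_one_of_one_le₀ (by nlinarith)) b
      _ ≤ exp (-Real.log (K / ε)) := by
          apply exp_le_exp.mpr
          have hK2 : 0 < K ^ 2 := by positivity
          have : Real.log (K / ε) ≤ b * (1 / K ^ 2) := by
            rw [one_div, ← div_eq_mul_inv, le_div_iff₀ hK2]
            linarith [mul_comm (Real.log (K / ε)) (K ^ 2)]
          linarith
      _ = ε / K := by
          rw [exp_neg, exp_log (by positivity), inv_div]
  -- conclude: `|f - 1/x| = (1-x²)^b/|x| ≤ (ε/K)/|x| ≤ ε`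
  rw [tamedInv_sub_inv, abs_neg, abs_div, abs_of_nonneg (pow_nonneg hbase0 b),
    div_le_iff₀ hxpos]
  calc (1 - x ^ 2) ^ b ≤ ε / K := hpow
    _ = ε * (1 / K) := by ring
    _ ≤ ε * |x| := mul_le_mul_of_nonneg_left hx1 hε.le

/-! ## §2 The Chernoff bound in the proof of Lemma 19 -/

/-- Exponential-moment identity for `2b` fair coins: `∑_{k=0}^{2b} binom(2b,k) e^{λk} = (1+e^λ)^{2b}`
(binomial theorem). [folklore] -/
private theorem sum_choose_mul_exp_eq (b : ℕ) (l : ℝ) :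
    ∑ k ∈ range (2 * b + 1), ((2 * b).choose k : ℝ) * exp (l * k) = (1 + exp l) ^ (2 * b) := by
  rw [add_comm (1 : ℝ), add_pow]
  refine sum_congr rfl fun k _ => ?_
  rw [one_pow, mul_one, mul_comm, ← exp_nat_mul, mul_comm (k : ℝ)]

/-- `(1 + e^λ)/2 = e^{λ/2} cosh(λ/2)`. [folklore] -/
private theorem one_add_exp_div_two (l : ℝ) : (1 + exp l) / 2 = exp (l / 2) * cosh (l / 2) := by
  rw [cosh_eq, ← mul_div_assoc, mul_add, ← exp_add, ← exp_add,
    show l / 2 + l / 2 = l by ring, show l / 2 + -(l / 2) = 0 by ring, exp_zero, add_comm]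

/-- The tail count is dominated by the tilted full sum (Markov's inequality for the exponential
moment): `∑_{i=j+1}^{b} binom(2b, b+i) ≤ e^{-λ(b+j)} (1 + e^λ)^{2b}` for `λ ≥ 0`. [folklore] -/
private theorem choose_tail_le_exp_mul (b j : ℕ) {l : ℝ} (hl : 0 ≤ l) :
    ∑ i ∈ Ioc j b, ((2 * b).choose (b + i) : ℝ) ≤
      exp (-(l * (b + j))) * (1 + exp l) ^ (2 * b) := by
  rw [← sum_choose_mul_exp_eq, mul_sum]
  -- reindex the tail by `k = b + i ∈ [b+j+1, 2b]` and compare termwise with the tilted sum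
  have hsub : ∑ i ∈ Ioc j b, ((2 * b).choose (b + i) : ℝ) =
      ∑ k ∈ (Ioc j b).map (addLeftEmbedding b), ((2 * b).choose k : ℝ) := by
    rw [sum_map]; rfl
  rw [hsub]
  have hsubset : (Ioc j b).map (addLeftEmbedding b) ⊆ range (2 * b + 1) := by
    intro k hk
    simp only [mem_map, mem_Ioc, addLeftEmbedding_apply] at hk
    obtain ⟨i, ⟨_, hib⟩, rfl⟩ := hk
    simp only [mem_range]; omega
  refine (sum_le_sum_of_subset_of_nonneg hsubset fun k _ _ => by positivity).trans' ?_
  refine sum_le_sum fun k hk => ?_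
  simp only [mem_map, mem_Ioc, addLeftEmbedding_apply] at hk
  obtain ⟨i, ⟨hji, _⟩, rfl⟩ := hk
  -- for `k = b + i` with `i > j`: `1 ≤ e^{-λ(b+j)} e^{λ k}`
  have hexp : (1 : ℝ) ≤ exp (-(l * (b + j))) * exp (l * ((b + i : ℕ) : ℝ)) := by
    rw [← exp_add]
    apply one_le_exp
    push_cast
    have : (j : ℝ) ≤ i := by exact_mod_cast hji.le
    nlinarith
  calc ((2 * b).choose (b + i) : ℝ) = ((2 * b).choose (b + i) : ℝ) * 1 := (mul_one _).symm
    _ ≤ ((2 * b).choose (b + i) : ℝ) * (exp (-(l * (b + j))) * exp (l * ((b + i : ℕ) : ℝ))) :=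
        mul_le_mul_of_nonneg_left hexp (by positivity)
    _ = exp (-(l * (b + j))) * (((2 * b).choose (b + i) : ℝ) * exp (l * ((b + i : ℕ) : ℝ))) := by
        ring

/-- **The Chernoff bound** of [cite: ChildsKothariSomma2017, proof of Lemma 19, eq. (Chernoff)]:
"the probability of seeing more than `b + j` heads on flipping `2b` fair coins" satisfies
`2^{-2b} ∑_{i=j+1}^{b} binom(2b, b+i) ≤ e^{-j²/b}`. -/
theorem choose_tail_div_le_exp (b j : ℕ) :
    (∑ i ∈ Ioc j b, ((2 * b).choose (b + i) : ℝ)) / 2 ^ (2 * b) ≤ exp (-((j : ℝ) ^ 2 / b)) := by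
  rcases Nat.eq_zero_or_pos b with rfl | hb
  · simp
  have hbpos : (0 : ℝ) < b := by exact_mod_cast hb
  -- tilt with `λ = 2j/b`
  set l : ℝ := 2 * j / b with hl
  have hl0 : 0 ≤ l := by positivity
  have h2pos : (0 : ℝ) < 2 ^ (2 * b) := by positivity
  rw [div_le_iff₀ h2pos]
  refine (choose_tail_le_exp_mul b j hl0).trans ?_
  -- `(1+e^λ)^{2b} = 2^{2b} e^{λ b} cosh(λ/2)^{2b}` and `cosh(λ/2) ≤ e^{λ²/8}`
  have hpow : (1 + exp l) ^ (2 * b) = 2 ^ (2 * b) * (exp (l / 2) * cosh (l / 2)) ^ (2 * b) := by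
    rw [← one_add_exp_div_two, div_pow, mul_div_cancel₀ _ h2pos.ne']
  have hcosh : (cosh (l / 2)) ^ (2 * b) ≤ (exp ((l / 2) ^ 2 / 2)) ^ (2 * b) :=
    pow_le_pow_left₀ (cosh_pos _).le (cosh_le_exp_half_sq _) _
  calc exp (-(l * (b + j))) * (1 + exp l) ^ (2 * b)
      = 2 ^ (2 * b) * (exp (-(l * (b + j))) * (exp (l / 2)) ^ (2 * b) * (cosh (l / 2)) ^ (2 * b)) := by
        rw [hpow, mul_pow]; ring
    _ ≤ 2 ^ (2 * b) * (exp (-(l * (b + j))) * (exp (l / 2)) ^ (2 * b) *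
          (exp ((l / 2) ^ 2 / 2)) ^ (2 * b)) := by
        gcongr
    _ = 2 ^ (2 * b) * exp (-(l * j) + b * l ^ 2 / 4) := by
        rw [← exp_nat_mul, ← exp_nat_mul, ← exp_add, ← exp_add]
        congr 1
        push_cast
        ring_nf
    _ = exp (-((j : ℝ) ^ 2 / b)) * 2 ^ (2 * b) := by
        rw [mul_comm]
        congr 1
        rw [hl]
        field_simp
        ring

/-! ## §3 Lemma 19: truncating the printed Chebyshev series -/

/-- The printed Chebyshev coefficients of `f_b`,
`c_j = 4 (-1)^j [2^{-2b} ∑_{i=j+1}^{b} binom(2b, b+i)]`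
[cite: ChildsKothariSomma2017, Lemma 18, eq. (exact)]. -/
noncomputable def chebCoeff (b j : ℕ) : ℝ :=
  4 * (-1) ^ j * ((∑ i ∈ Ioc j b, ((2 * b).choose (b + i) : ℝ)) / 2 ^ (2 * b))

/-- The printed series `∑_{j=0}^{b-1} c_j 𝒯_{2j+1}(x)` of
[cite: ChildsKothariSomma2017, Lemma 18, eq. (exact)] (equal to `f_b(x)` on `[-1,1]` by Lemma 18,
which is not formalized here). -/
noncomputable def chebSeries (b : ℕ) (x : ℝ) : ℝ :=
  ∑ j ∈ range b, chebCoeff b j * (Polynomial.Chebyshev.T ℝ (2 * j + 1)).eval x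

/-- Its truncation `g(x) = ∑_{j=0}^{j₀} c_j 𝒯_{2j+1}(x)` [cite: ChildsKothariSomma2017, Lemma 19,
eq. (truncated)] (terms with `j ≥ b` vanish, so the sum is cut at `min (j₀+1) b`). -/
noncomputable def chebTrunc (b j₀ : ℕ) (x : ℝ) : ℝ :=
  ∑ j ∈ range (min (j₀ + 1) b), chebCoeff b j * (Polynomial.Chebyshev.T ℝ (2 * j + 1)).eval x

/-- `|c_j| ≤ 4 e^{-j²/b}` — the Chernoff bound applied to the printed coefficients, the step
`≤ 4 ∑ e^{-j²/b} |𝒯_{2j+1}(x)|` of [cite: ChildsKothariSomma2017, proof of Lemma 19]. -/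
theorem abs_chebCoeff_le (b j : ℕ) : |chebCoeff b j| ≤ 4 * exp (-((j : ℝ) ^ 2 / b)) := by
  unfold chebCoeff
  rw [abs_mul, abs_mul, abs_pow, abs_neg, abs_one, one_pow, mul_one,
    abs_of_nonneg (by norm_num : (0 : ℝ) ≤ 4),
    abs_of_nonneg (div_nonneg (sum_nonneg fun _ _ => by positivity) (by positivity))]
  exact mul_le_mul_of_nonneg_left (choose_tail_div_le_exp b j) (by norm_num)

/-- The tail of the printed series: `f - g = ∑_{j=j₀+1}^{b-1} c_j 𝒯_{2j+1}`, the first line of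
the display in [cite: ChildsKothariSomma2017, proof of Lemma 19]. -/
theorem chebSeries_sub_chebTrunc (b j₀ : ℕ) (x : ℝ) :
    chebSeries b x - chebTrunc b j₀ x =
      ∑ j ∈ Ioo j₀ b, chebCoeff b j * (Polynomial.Chebyshev.T ℝ (2 * j + 1)).eval x := by
  unfold chebSeries chebTrunc
  have hsplit : range b = range (min (j₀ + 1) b) ∪ Ioo j₀ b := by
    ext j; simp only [mem_union, mem_range, mem_Ioo]; omega
  have hdisj : Disjoint (range (min (j₀ + 1) b)) (Ioo j₀ b) := by
    rw [disjoint_left]; intro j h1 h2; simp only [mem_range, mem_Ioo] at h1 h2; omega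
  rw [hsplit, sum_union hdisj, add_sub_cancel_left]

/-- **Lemma 19 as proved** [cite: ChildsKothariSomma2017, proof of Lemma 19]: for `|x| ≤ 1`,
`|∑_{j=j₀+1}^{b-1} c_j 𝒯_{2j+1}(x)| ≤ 4 ∑_{j=j₀+1}^{b-1} e^{-j²/b} ≤ 4b e^{-j₀²/b}`. -/
theorem abs_chebSeries_sub_chebTrunc_le (b j₀ : ℕ) {x : ℝ} (hx : |x| ≤ 1) :
    |chebSeries b x - chebTrunc b j₀ x| ≤ 4 * b * exp (-((j₀ : ℝ) ^ 2 / b)) := by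
  rw [chebSeries_sub_chebTrunc]
  refine (abs_sum_le_sum_abs _ _).trans ?_
  -- each tail term is at most `4 e^{-j²/b} ≤ 4 e^{-j₀²/b}`
  have hterm : ∀ j ∈ Ioo j₀ b,
      |chebCoeff b j * (Polynomial.Chebyshev.T ℝ (2 * j + 1)).eval x| ≤
        4 * exp (-((j₀ : ℝ) ^ 2 / b)) := by
    intro j hj
    rw [mem_Ioo] at hj
    rw [abs_mul]
    have hT : |(Polynomial.Chebyshev.T ℝ (2 * j + 1)).eval x| ≤ 1 := by
      have := Polynomial.Chebyshev.abs_eval_T_real_le_one ((2 * j + 1 : ℕ) : ℤ) hx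
      simpa using this
    calc |chebCoeff b j| * |(Polynomial.Chebyshev.T ℝ (2 * j + 1)).eval x|
        ≤ 4 * exp (-((j : ℝ) ^ 2 / b)) * 1 :=
          mul_le_mul (abs_chebCoeff_le b j) hT (abs_nonneg _) (by positivity)
      _ ≤ 4 * exp (-((j₀ : ℝ) ^ 2 / b)) := by
          rw [mul_one]
          refine mul_le_mul_of_nonneg_left (exp_le_exp.mpr ?_) (by norm_num)
          have hjj : (j₀ : ℝ) ≤ j := by exact_mod_cast hj.1.le
          have hb0 : (0 : ℝ) ≤ b := by positivity
          have : (j₀ : ℝ) ^ 2 / b ≤ (j : ℝ) ^ 2 / b :=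
            div_le_div_of_nonneg_right (by nlinarith) hb0
          linarith
  refine (sum_le_sum hterm).trans ?_
  rw [sum_const, nsmul_eq_mul]
  have hcard : ((Ioo j₀ b).card : ℝ) ≤ b := by
    rw [Nat.card_Ioo]; exact_mod_cast (Nat.sub_le _ _).trans (Nat.sub_le _ _)
  nlinarith [exp_pos (-((j₀ : ℝ) ^ 2 / b))]

/-- **Lemma 19, the `ε` form** [cite: ChildsKothariSomma2017, Lemma 19]: if `j₀² ≥ b log(4b/ε)`
(the printed choice `j₀ = √(b log(4b/ε))`), then the truncated series is `ε`-close to the full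
printed series on `[-1,1]`. -/
theorem abs_chebSeries_sub_chebTrunc_le_of_le {b j₀ : ℕ} {ε : ℝ} (hε : 0 < ε)
    (hj₀ : (b : ℝ) * Real.log (4 * b / ε) ≤ (j₀ : ℝ) ^ 2) {x : ℝ} (hx : |x| ≤ 1) :
    |chebSeries b x - chebTrunc b j₀ x| ≤ ε := by
  rcases Nat.eq_zero_or_pos b with rfl | hb
  · simp [chebSeries, chebTrunc, hε.le]
  have hbpos : (0 : ℝ) < b := by exact_mod_cast hb
  refine (abs_chebSeries_sub_chebTrunc_le b j₀ hx).trans ?_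
  -- `4b e^{-j₀²/b} ≤ 4b e^{-log(4b/ε)} = ε`
  have hlog : Real.log (4 * b / ε) ≤ (j₀ : ℝ) ^ 2 / b := by
    rw [le_div_iff₀ hbpos]; linarith [mul_comm (Real.log (4 * b / ε)) (b : ℝ)]
  calc 4 * (b : ℝ) * exp (-((j₀ : ℝ) ^ 2 / b))
      ≤ 4 * b * exp (-Real.log (4 * b / ε)) := by
        gcongr
    _ = ε := by
        rw [exp_neg, exp_log (by positivity), inv_div]
        field_simp

end ChebyshevInverse

end Literature.Computability.QuantumAlgorithms
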